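import Summits.Ventures.GridStability.Models.WSCC9SplitLurie
import Summits.Ventures.GridStability.Lyapunov.WSCC9LossySplitSlabData
import Summits.Ventures.GridStability.Lyapunov.WSCC9LurieObstructionTests
import Literature.MathematicalPhysics.PowerSystems.LuriePostnikovSlabCertificate
import HarnessLib

/-!
# GridStability/Lyapunov/WSCC9LossySplitSlabCast — the SPLIT Lur'e object `WSCC9.splitLurieSystem` as casts of
# rational matrices, the KERNEL IDENTITY `−𝓛 = M2q`, and sos-2's slab certificate as lit-6's `SlabCertificate`
# (#35 «G2.c-WSCC9-LOSSY-SLAB», LANE F1, file 2/3)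

Cell `gridfusion` (LADDER-GRIDFUSION G2.c lossy tier); lead 07:18:16Z / (R-b) 08:21:31Z, director RULING 29
ADDENDUM 1 (2); seat gridfusion-lyap-2 (g0). Inputs: `Lyapunov/WSCC9LossySplitSlabData.lean` (sos-2 Λ
`9255093d`, kernel-decided Gram certificates), model-1's object `Models/WSCC9SplitLurie.lean` (p508678:
`WSCC9.splitLurieSystem = postB_SPdamp.toModel.toLitNode.toSplitLurie angleOf`, lit-6 §7), lit-6's receptacle
`LuriePostnikovSlabCertificate.lean` (`slabMatrix`, `SlabCertificate`), lyap-1's definitional unfoldings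
`tE / tM / tD` (`Lyapunov/WSCC9LurieObstructionTests.lean`).

WHAT IS PROVED. (1) STRUCTURE: `S.A`, `S.B`, `S.C` of `S = WSCC9.splitLurieSystem` are the casts of the
rational matrices `AQ = [[−diag(D/M), 0], [refT, 0]]`, `BQ = [directedInput (1/M) (fst ⊔ fst) splitWeight; 0]`
(weights `C_pq = E_pE_qB_pq` on the sine channels, `D_pq = E_pE_qG_pq` on the cosine channels — RATIONAL, the
point of the split presentation) and `CQ = [0 | pairIncidence; pairIncidence]` (`A_eq`, `B_eq`, `C_eq`).
(2) THE KERNEL IDENTITY: lit-6's blocks computed over `ℚ` from `AQ, BQ, CQ` and the certificate data EQUAL the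
decided literal: `−[[L₁₁, L₁₂], [L₁₂ᵀ, L₂₂]] = M2q` reindexed (`slabQ_eq`, one `decide +kernel`), hence
`−slabMatrix S P η λ τ a b = (M2q ↦ ℝ)` reindexed (`neg_slabMatrix_eq`) and `P − ε·1 = (Pq − epsQ·1 ↦ ℝ)`
reindexed (`P_sub_eq`). (3) THE CERTIFICATE `cert : SlabCertificate WSCC9.splitLurieSystem` with the exact data
(`P`, `ε = 38037/2²³`, `η = 10⁻⁶`, `τ`, `λ`, `a`, `b`), both matrix facts from the integer Gram certificates.
(4) RANK-ONE facts in `S`-typed form: `rankOne : ∀ k, (s_k • cert.P − C_kC_kᵀ) ⪰ 0` (from the four class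
certificates via the decided reindexing `rankOneQ_eq`).  The sector hypothesis, the level and the sentence are
`Bench/WSCC9LossySplitSlabRoa.lean`.

THREE COLUMNS. CERTIFIED (kernel): the identities and the certificate's defining facts for the MODEL
`WSCC9.splitLurieSystem` = Pai's SPLIT Lur'e form (3.43)–(3.45) of M′ = «WSCC9-postB-SPdamp-h12» (post-fault-B
reduction WITH transfer conductances, printed damping `D/M = 1/10, 1/5, 3/10`). VALIDATED: sos-2's solver
lineage (CVXOPT), irrelevant to soundness. MODELLED: as `Models/WSCC9.lean` / `ClassicalSwingLurie.lean` /
`WSCC9SplitLurie.lean` (MV-2 + MV-P + MV-SPD + MV-ω + MV-h12). No sentence of this file says a grid is stable.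
-/

noncomputable section

open Matrix
open Literature.MathematicalPhysics.PowerSystems
open Literature.MathematicalPhysics.PowerSystems.LyapunovFunctionFamily
open Literature.Computation.Certificates
open Summit.Ventures.GridStability.Models
open Summit.Ventures.GridStability.Lyapunov.LurieObstruction (tE tM tD)

namespace Summit.Ventures.GridStability.Lyapunov.WSCC9LossySplitSlab

/-! ### Index flattenings (the Data file's conventions) -/

/-- States `Fin 3 ⊕ Fin 2 ≃ Fin 5` (`ω₀, ω₁, ω₂, σ₁, σ₂`). -/
def e1 : Fin 3 ⊕ Fin 2 ≃ Fin 5 := finSumFinEquiv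

/-- Channels `(Fin 3 × Fin 3) ⊕ (Fin 3 × Fin 3) ≃ Fin 18`: sine `(p, q) ↦ 3p + q`, cosine `(p, q) ↦ 9 + 3p + q`. -/
def eκ : (Fin 3 × Fin 3) ⊕ (Fin 3 × Fin 3) ≃ Fin 18 :=
  (Equiv.sumCongr finProdFinEquiv finProdFinEquiv).trans finSumFinEquiv

/-- Certificate-matrix index `(Fin 3 ⊕ Fin 2) ⊕ ((Fin 3 × Fin 3) ⊕ (Fin 3 × Fin 3)) ≃ Fin 23`. -/
def e2 : (Fin 3 ⊕ Fin 2) ⊕ ((Fin 3 × Fin 3) ⊕ (Fin 3 × Fin 3)) ≃ Fin 23 :=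
  (Equiv.sumCongr e1 eκ).trans finSumFinEquiv

/-! ### The object's matrices over `ℚ` -/

/-- `D_i/M_i` over `ℚ`. -/
def lamMQ (i : Fin 3) : ℚ := WSCC9.D_SP i / WSCC9.M i

/-- `1/M_i` over `ℚ`. -/
def MinvQ (i : Fin 3) : ℚ := 1 / WSCC9.M i

/-- `A = [[−diag(D/M), 0], [refT, 0]]` over `ℚ`. -/
def AQ : Matrix (Fin 3 ⊕ Fin 2) (Fin 3 ⊕ Fin 2) ℚ :=
  Matrix.fromBlocks (-Matrix.diagonal lamMQ) 0
    (Matrix.of fun a i => (if i = a.succ then 1 else 0) - (if i = 0 then 1 else 0)) 0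

/-- The split channel weights over `ℚ`: `C_pq = E_pE_qB_pq` (sine), `D_pq = E_pE_qG_pq` (cosine), `0` diagonal. -/
def wQ : (Fin 3 × Fin 3) ⊕ (Fin 3 × Fin 3) → ℚ :=
  Sum.elim (fun k => if k.1 = k.2 then 0 else WSCC9.postB_SPdamp.Cc k.1 k.2)
    (fun k => if k.1 = k.2 then 0 else WSCC9.postB_SPdamp.Dc k.1 k.2)

/-- The source machine of a channel (both families: the first index). -/
def srcK : (Fin 3 × Fin 3) ⊕ (Fin 3 × Fin 3) → Fin 3 := Sum.elim Prod.fst Prod.fst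

/-- `B = [directedInput (1/M) src w; 0]` over `ℚ`. -/
def BQ : Matrix (Fin 3 ⊕ Fin 2) ((Fin 3 × Fin 3) ⊕ (Fin 3 × Fin 3)) ℚ :=
  Matrix.fromRows (Matrix.of fun i k => if srcK k = i then wQ k * MinvQ i else 0) 0

/-- The ordered-pair incidence over `ℚ`. -/
def pairIncQ : Matrix (Fin 3 × Fin 3) (Fin 2) ℚ :=
  Matrix.of fun k a => (if k.1 = a.succ then 1 else 0) - (if k.2 = a.succ then 1 else 0)

/-- `C = [0 | pairIncidence; pairIncidence]` over `ℚ`. -/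
def CQ : Matrix ((Fin 3 × Fin 3) ⊕ (Fin 3 × Fin 3)) (Fin 3 ⊕ Fin 2) ℚ :=
  Matrix.fromCols 0 (Matrix.fromRows pairIncQ pairIncQ)

/-- `P` on the typed state index. -/
def PQ : Matrix (Fin 3 ⊕ Fin 2) (Fin 3 ⊕ Fin 2) ℚ := Pq.submatrix e1 e1

/-- `τ` on the typed channel index. -/
def tauK (k : (Fin 3 × Fin 3) ⊕ (Fin 3 × Fin 3)) : ℚ := tauQ (eκ k)
/-- `λ` on the typed channel index. -/
def lamK (k : (Fin 3 × Fin 3) ⊕ (Fin 3 × Fin 3)) : ℚ := lamQ (eκ k)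
/-- `a` on the typed channel index. -/
def aK (k : (Fin 3 × Fin 3) ⊕ (Fin 3 × Fin 3)) : ℚ := aQ (eκ k)
/-- `b` on the typed channel index. -/
def bK (k : (Fin 3 × Fin 3) ⊕ (Fin 3 × Fin 3)) : ℚ := bQ (eκ k)
/-- rank-one constant `s` on the typed channel index. -/
def sK (k : (Fin 3 × Fin 3) ⊕ (Fin 3 × Fin 3)) : ℚ := sQ (eκ k)

/-! ### The blocks of `𝓛` over `ℚ` (lit-6's formulas) and the decided identity with `M2q` -/

/-- State block over `ℚ`: `AᵀP + PA + η·1 − Cᵀ·diag(τab)·C`. -/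
def L11Q : Matrix (Fin 3 ⊕ Fin 2) (Fin 3 ⊕ Fin 2) ℚ :=
  AQᵀ * PQ + PQ * AQ + etaQ • (1 : Matrix (Fin 3 ⊕ Fin 2) (Fin 3 ⊕ Fin 2) ℚ)
    - CQᵀ * Matrix.diagonal (fun k => tauK k * (aK k * bK k)) * CQ

/-- Cross block over `ℚ`: `−PB + (CA)ᵀ·diag(λ) + Cᵀ·diag(τ(a+b)/2)`. -/
def L12Q : Matrix (Fin 3 ⊕ Fin 2) ((Fin 3 × Fin 3) ⊕ (Fin 3 × Fin 3)) ℚ :=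
  -(PQ * BQ) + (CQ * AQ)ᵀ * Matrix.diagonal lamK + CQᵀ * Matrix.diagonal (fun k => tauK k * (aK k + bK k) / 2)

/-- Channel block over `ℚ`: `−diag(λ)·CB − (diag(λ)·CB)ᵀ − diag τ`. -/
def L22Q : Matrix ((Fin 3 × Fin 3) ⊕ (Fin 3 × Fin 3)) ((Fin 3 × Fin 3) ⊕ (Fin 3 × Fin 3)) ℚ :=
  -(Matrix.diagonal lamK * (CQ * BQ)) - (Matrix.diagonal lamK * (CQ * BQ))ᵀ - Matrix.diagonal tauK

set_option maxHeartbeats 400000 in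
/-- **The exact certificate matrix**: `−𝓛 = M2q` (reindexed), decided in the kernel over `ℚ`. -/
theorem slabQ_eq : -(Matrix.fromBlocks L11Q L12Q L12Qᵀ L22Q) = M2q.submatrix e2 e2 := by
  decide +kernel

/-- `PQ` is symmetric (kernel). -/
theorem PQ_transpose : PQᵀ = PQ := by
  decide +kernel

/-- **The rank-one matrices, reindexed**: `s_k·P − C_kᵀC_k` on the typed indices IS the class matrix of the Data
file (kernel, all 18 channels). -/
theorem rankOneQ_eq : ∀ k, sK k • PQ - Matrix.vecMulVec (CQ k) (CQ k)
    = (sClsQ (cls (eκ k)) • Pq - Matrix.vecMulVec (vQ (cls (eκ k))) (vQ (cls (eκ k)))).submatrix e1 e1 := by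
  decide +kernel

/-! ### The certificate data over `ℝ` -/

/-- `P` (real). -/
def P : Matrix (Fin 3 ⊕ Fin 2) (Fin 3 ⊕ Fin 2) ℝ := PQ.map (Rat.cast : ℚ → ℝ)
/-- `τ` (real). -/
def τ : (Fin 3 × Fin 3) ⊕ (Fin 3 × Fin 3) → ℝ := fun k => (tauK k : ℝ)
/-- `λ` (real, Popov coefficients). -/
def lam : (Fin 3 × Fin 3) ⊕ (Fin 3 × Fin 3) → ℝ := fun k => (lamK k : ℝ)
/-- lower slopes (real). -/
def a : (Fin 3 × Fin 3) ⊕ (Fin 3 × Fin 3) → ℝ := fun k => (aK k : ℝ)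
/-- upper slopes (real). -/
def b : (Fin 3 × Fin 3) ⊕ (Fin 3 × Fin 3) → ℝ := fun k => (bK k : ℝ)

/-! ### Cast plumbing -/

/-- `(M·N) ↦ ℝ` = product of the casts (plumbing). -/
private theorem map_mul' {m n o : Type*} [Fintype n] (M : Matrix m n ℚ) (N : Matrix n o ℚ) :
    (M * N).map (Rat.cast : ℚ → ℝ) = M.map (Rat.cast : ℚ → ℝ) * N.map (Rat.cast : ℚ → ℝ) :=
  Matrix.map_mul (f := Rat.castHom ℝ)

/-- `(M+N) ↦ ℝ` = sum of the casts (plumbing). -/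
private theorem map_add' {m n : Type*} (M N : Matrix m n ℚ) :
    (M + N).map (Rat.cast : ℚ → ℝ) = M.map (Rat.cast : ℚ → ℝ) + N.map (Rat.cast : ℚ → ℝ) := by
  ext i j; simp

/-- `(M−N) ↦ ℝ` = difference of the casts (plumbing). -/
private theorem map_sub' {m n : Type*} (M N : Matrix m n ℚ) :
    (M - N).map (Rat.cast : ℚ → ℝ) = M.map (Rat.cast : ℚ → ℝ) - N.map (Rat.cast : ℚ → ℝ) := by
  ext i j; simp

/-- `(−M) ↦ ℝ` = minus the cast (plumbing). -/
private theorem map_neg' {m n : Type*} (M : Matrix m n ℚ) :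
    (-M).map (Rat.cast : ℚ → ℝ) = -M.map (Rat.cast : ℚ → ℝ) := by
  ext i j; simp

/-- transpose commutes with the cast (plumbing, `rfl`). -/
private theorem map_transpose' {m n : Type*} (M : Matrix m n ℚ) :
    Mᵀ.map (Rat.cast : ℚ → ℝ) = (M.map (Rat.cast : ℚ → ℝ))ᵀ := rfl

/-- `diag(d) ↦ ℝ = diag(d ↦ ℝ)` (plumbing). -/
private theorem map_diagonal' {n : Type*} [DecidableEq n] (d : n → ℚ) :
    (Matrix.diagonal d).map (Rat.cast : ℚ → ℝ) = Matrix.diagonal (fun i => (d i : ℝ)) :=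
  Matrix.diagonal_map Rat.cast_zero

/-- `(q·1) ↦ ℝ = (q ↦ ℝ)·1` (plumbing). -/
private theorem map_smul_one' {n : Type*} [DecidableEq n] (q : ℚ) :
    (q • (1 : Matrix n n ℚ)).map (Rat.cast : ℚ → ℝ) = (q : ℝ) • (1 : Matrix n n ℝ) := by
  ext i j
  by_cases h : i = j
  · subst h; simp
  · simp [h]

/-- `(q·M) ↦ ℝ = (q ↦ ℝ)·(M ↦ ℝ)` (plumbing). -/
private theorem map_smul' {m n : Type*} (q : ℚ) (M : Matrix m n ℚ) :
    (q • M).map (Rat.cast : ℚ → ℝ) = (q : ℝ) • M.map (Rat.cast : ℚ → ℝ) := by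
  ext i j; simp

/-- `(v vᵀ) ↦ ℝ = (v ↦ ℝ)(v ↦ ℝ)ᵀ` (plumbing). -/
private theorem map_vecMulVec' {m n : Type*} (v : m → ℚ) (w : n → ℚ) :
    (Matrix.vecMulVec v w).map (Rat.cast : ℚ → ℝ)
      = Matrix.vecMulVec (fun i => (v i : ℝ)) (fun j => (w j : ℝ)) := by
  ext i j; simp [Matrix.vecMulVec_apply]

/-! ### The object `WSCC9.splitLurieSystem`: its matrices are the casts -/

/-- `A` of the split system (definitional unfolding of lit-6's `toSplitLurie`). -/
theorem splitLurieSystem_A : WSCC9.splitLurieSystem.A =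
    Matrix.fromBlocks (-Matrix.diagonal
      (fun i => WSCC9.postB_SPdamp.toModel.toLitNode.D i / WSCC9.postB_SPdamp.toModel.toLitNode.M i))
      0 (InternalNode.refT 2) 0 := rfl

/-- `B` of the split system (definitional unfolding). -/
theorem splitLurieSystem_B : WSCC9.splitLurieSystem.B =
    Matrix.fromRows (System.directedInput (fun i => 1 / WSCC9.postB_SPdamp.toModel.toLitNode.M i)
      (Sum.elim Prod.fst Prod.fst) WSCC9.postB_SPdamp.toModel.toLitNode.splitWeight) 0 := rfl

/-- `C` of the split system (definitional unfolding). -/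
theorem splitLurieSystem_C : WSCC9.splitLurieSystem.C =
    Matrix.fromCols 0 (Matrix.fromRows (InternalNode.pairIncidence 2) (InternalNode.pairIncidence 2)) := rfl

/-- `δ*` of the split system is lit-6's `splitShift` of the A1 angles (definitional unfolding). -/
theorem splitLurieSystem_δs : WSCC9.splitLurieSystem.δs = InternalNode.splitShift WSCC9.postB_SPdamp.angleOf := rfl

/-- `toLitNode.M = M` (typed rationals). -/
private theorem tM' (i : Fin 3) : WSCC9.postB_SPdamp.toModel.toLitNode.M i = ((WSCC9.M i : ℚ) : ℝ) := by
  rw [ClassicalSwing.toLitNode_M]; rfl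

/-- `toLitNode.C p q = (Cc p q : ℝ)` — the sine weights are the typed rationals `E_pE_qB_pq`. -/
private theorem tC' (p q : Fin 3) :
    WSCC9.postB_SPdamp.toModel.toLitNode.C p q = ((WSCC9.postB_SPdamp.Cc p q : ℚ) : ℝ) := by
  simp only [InternalNode.C, RecastData.Cc, Rat.cast_mul]; rfl

/-- `toLitNode.Dtr p q = (Dc p q : ℝ)` — the cosine weights are the typed rationals `E_pE_qG_pq`. -/
private theorem tDtr' (p q : Fin 3) :
    WSCC9.postB_SPdamp.toModel.toLitNode.Dtr p q = ((WSCC9.postB_SPdamp.Dc p q : ℚ) : ℝ) := by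
  simp only [InternalNode.Dtr, RecastData.Dc, Rat.cast_mul]; rfl

/-- The split weights are the casts of `wQ`. -/
private theorem splitWeight_eq (k : (Fin 3 × Fin 3) ⊕ (Fin 3 × Fin 3)) :
    WSCC9.postB_SPdamp.toModel.toLitNode.splitWeight k = ((wQ k : ℚ) : ℝ) := by
  rcases k with ⟨p, q⟩ | ⟨p, q⟩
  · by_cases h : p = q
    · simp [InternalNode.splitWeight, wQ, h]
    · simp [InternalNode.splitWeight, wQ, h, tC']
  · by_cases h : p = q
    · simp [InternalNode.splitWeight, wQ, h]
    · simp [InternalNode.splitWeight, wQ, h, tDtr']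

/-- `S.A = AQ ↦ ℝ`. -/
theorem A_eq : WSCC9.splitLurieSystem.A = AQ.map (Rat.cast : ℚ → ℝ) := by
  rw [splitLurieSystem_A]
  ext a b
  rcases a with i | m <;> rcases b with i' | m'
  · by_cases h : i = i'
    · subst h
      simp [Matrix.fromBlocks, AQ, Matrix.diagonal, tD, tM, lamMQ]
    · simp [Matrix.fromBlocks, AQ, Matrix.diagonal, h]
  · simp [Matrix.fromBlocks, AQ]
  · simp only [Matrix.fromBlocks_apply₂₁, InternalNode.refT, Matrix.of_apply, AQ, Matrix.map_apply]
    split_ifs <;> norm_num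
  · simp [Matrix.fromBlocks, AQ]

/-- `S.B = BQ ↦ ℝ`. -/
theorem B_eq : WSCC9.splitLurieSystem.B = BQ.map (Rat.cast : ℚ → ℝ) := by
  rw [splitLurieSystem_B]
  ext a k
  rcases a with i | m
  · simp only [Matrix.fromRows_apply_inl, System.directedInput, Matrix.of_apply, Matrix.map_apply, BQ,
      splitWeight_eq, tM', MinvQ]
    have hsrc : Sum.elim Prod.fst Prod.fst k = srcK k := rfl
    rw [hsrc]
    split_ifs <;> push_cast <;> ring
  · simp [BQ]

/-- `S.C = CQ ↦ ℝ`. -/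
theorem C_eq : WSCC9.splitLurieSystem.C = CQ.map (Rat.cast : ℚ → ℝ) := by
  rw [splitLurieSystem_C]
  ext k b
  rcases b with i | m
  · rcases k with k | k <;> simp [CQ]
  · rcases k with k | k <;>
      simp only [Matrix.fromCols_apply_inr, Matrix.fromRows_apply_inl, Matrix.fromRows_apply_inr,
        InternalNode.pairIncidence, Matrix.of_apply, CQ, pairIncQ, Matrix.map_apply] <;>
      split_ifs <;> norm_num

/-! ### The blocks of the certificate matrix over `ℝ` are the casts -/

/-- State block. -/
theorem L11_eq : slabL11 WSCC9.splitLurieSystem P (etaQ : ℝ) τ a b = L11Q.map (Rat.cast : ℚ → ℝ) := by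
  have hd : Matrix.diagonal (fun k => τ k * (a k * b k))
      = (Matrix.diagonal (fun k => tauK k * (aK k * bK k))).map (Rat.cast : ℚ → ℝ) := by
    rw [map_diagonal']
    congr 1; funext k; simp [τ, a, b]
  rw [slabL11, A_eq, C_eq, hd, P, L11Q]
  simp only [map_sub', map_add', map_mul', map_transpose', map_smul_one']

/-- Cross block. -/
theorem L12_eq : slabL12 WSCC9.splitLurieSystem P lam τ a b = L12Q.map (Rat.cast : ℚ → ℝ) := by
  have hd1 : Matrix.diagonal lam = (Matrix.diagonal lamK).map (Rat.cast : ℚ → ℝ) := by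
    rw [map_diagonal']; rfl
  have hd2 : Matrix.diagonal (fun k => τ k * (a k + b k) / 2)
      = (Matrix.diagonal (fun k => tauK k * (aK k + bK k) / 2)).map (Rat.cast : ℚ → ℝ) := by
    rw [map_diagonal']
    congr 1; funext k; simp [τ, a, b]
  rw [slabL12, A_eq, B_eq, C_eq, hd1, hd2, P, L12Q]
  simp only [map_add', map_neg', map_mul', map_transpose']

/-- Channel block. -/
theorem L22_eq : slabL22 WSCC9.splitLurieSystem lam τ = L22Q.map (Rat.cast : ℚ → ℝ) := by
  have hd1 : Matrix.diagonal lam = (Matrix.diagonal lamK).map (Rat.cast : ℚ → ℝ) := by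
    rw [map_diagonal']; rfl
  have hd3 : Matrix.diagonal τ = (Matrix.diagonal tauK).map (Rat.cast : ℚ → ℝ) := by
    rw [map_diagonal']; rfl
  rw [slabL22, B_eq, C_eq, hd1, hd3, L22Q]
  simp only [map_sub', map_neg', map_mul', map_transpose']

/-- **`−𝓛` over `ℝ` is the reindexed cast of `M2q`.** -/
theorem neg_slabMatrix_eq : -(slabMatrix WSCC9.splitLurieSystem P (etaQ : ℝ) lam τ a b)
    = (M2q.map (Rat.cast : ℚ → ℝ)).submatrix e2 e2 := by
  rw [slabMatrix, L11_eq, L12_eq, L22_eq, ← map_transpose', ← Matrix.fromBlocks_map, ← map_neg', slabQ_eq]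
  rfl

/-- `P − ε·1` over `ℝ` is the reindexed cast of `Pq − epsQ·1`. -/
theorem P_sub_eq : P - (epsQ : ℝ) • (1 : Matrix (Fin 3 ⊕ Fin 2) (Fin 3 ⊕ Fin 2) ℝ)
    = ((Pq - epsQ • (1 : Matrix (Fin 5) (Fin 5) ℚ)).map (Rat.cast : ℚ → ℝ)).submatrix e1 e1 := by
  ext i j
  by_cases h : i = j
  · subst h; simp [P, PQ]
  · have h' : e1 i ≠ e1 j := fun he => h (e1.injective he)
    simp [P, PQ, h, h']

/-! ### The certificate -/

/-- **sos-2's SLAB CERTIFICATE «WSCC9SPLIT-slab-u1o50-well-eps» as lit-6's `SlabCertificate` for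
`WSCC9.splitLurieSystem`**: data (`P`, `ε = 38037/2²³`, `η = 10⁻⁶`, `τ`, `λ`, `a`, `b`) = the exact rationals of
`WSCC9LossySplitSlabData`; `P − ε·1 ⪰ 0` and `−𝓛 ⪰ 0` from the kernel-decided integer Gram certificates through
the identities `P_sub_eq` / `neg_slabMatrix_eq`. [cite: Pai1981, §2.16 Theorem [18] eqs. (2.63)–(2.64); VuTuritsyn2017, §4.2 Lemma 1] -/
def cert : SlabCertificate WSCC9.splitLurieSystem where
  P := P
  ε := (epsQ : ℝ)
  η := (etaQ : ℝ)
  τ := τ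
  lam := lam
  a := a
  b := b
  P_symm := by
    show (PQ.map (Rat.cast : ℚ → ℝ))ᵀ = PQ.map (Rat.cast : ℚ → ℝ)
    rw [← map_transpose', PQ_transpose]
  ε_pos := by exact_mod_cast eps_eta_pos.1
  η_pos := by exact_mod_cast eps_eta_pos.2
  P_ge := by
    rw [P_sub_eq]
    exact (Matrix.posSemidef_submatrix_equiv e1).2 posSemidef_M1_M2.1
  τ_nonneg := fun k => by unfold τ tauK; exact_mod_cast (mult_nonneg (eκ k)).1
  lam_nonneg := fun k => by unfold lam lamK; exact_mod_cast (mult_nonneg (eκ k)).2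
  a_nonneg_of_lam_pos := fun k hk => by
    unfold a aK
    have hk' : 0 < lamQ (eκ k) := by unfold lam lamK at hk; exact_mod_cast hk
    exact_mod_cast aQ_nonneg_of_lamQ_pos (eκ k) hk'
  lmi := by
    rw [neg_slabMatrix_eq]
    exact (Matrix.posSemidef_submatrix_equiv e2).2 posSemidef_M1_M2.2

/-- The certificate's slopes are the Data file's rationals (definitional). -/
theorem cert_a_b (k : (Fin 3 × Fin 3) ⊕ (Fin 3 × Fin 3)) :
    cert.a k = ((aQ (eκ k) : ℚ) : ℝ) ∧ cert.b k = ((bQ (eκ k) : ℚ) : ℝ) := ⟨rfl, rfl⟩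

/-- The certificate's `ε` is the Data file's rational (definitional). -/
theorem cert_ε : cert.ε = ((epsQ : ℚ) : ℝ) := rfl

/-! ### The rank-one facts in `S`-typed form -/

/-- **Rank-one facts** `s_k·P − C_kᵀC_k ⪰ 0` for every channel of `WSCC9.splitLurieSystem`, with sos-2's dyadic
`s_k` (from the four class certificates of the Data file). [cite: VuTuritsyn2017, §4.3 Theorem 1 (eq. V_min)] -/
theorem rankOne (k : (Fin 3 × Fin 3) ⊕ (Fin 3 × Fin 3)) :
    (((sK k : ℚ) : ℝ) • cert.P
      - Matrix.vecMulVec (WSCC9.splitLurieSystem.C k) (WSCC9.splitLurieSystem.C k)).PosSemidef := by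
  have hC : WSCC9.splitLurieSystem.C k = fun i => ((CQ k i : ℚ) : ℝ) := by
    rw [C_eq]; rfl
  have h : ((sK k : ℚ) : ℝ) • cert.P
      - Matrix.vecMulVec (WSCC9.splitLurieSystem.C k) (WSCC9.splitLurieSystem.C k)
      = (sK k • PQ - Matrix.vecMulVec (CQ k) (CQ k)).map (Rat.cast : ℚ → ℝ) := by
    rw [hC, map_sub', map_smul', map_vecMulVec']
    rfl
  rw [h, rankOneQ_eq k, ← Matrix.submatrix_map]
  exact (Matrix.posSemidef_submatrix_equiv e1).2 (posSemidef_rankOne _)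

/-- `0 < s_k` (real). -/
theorem sK_pos (k : (Fin 3 × Fin 3) ⊕ (Fin 3 × Fin 3)) : (0 : ℝ) < ((sK k : ℚ) : ℝ) := by
  unfold sK; exact_mod_cast (cRk_test (eκ k)).1

end Summit.Ventures.GridStability.Lyapunov.WSCC9LossySplitSlab

end
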